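import Literature.AlgebraicGeometry.Frobenioids.KummerDualityOfCupProduct
import Literature.NumberTheory.GaloisRepresentations.LocalGlobalCohomologyDualityProofs
import HarnessLib

/-!
# Frobenioids II, Def. 2.2 (ii): `θ : H_A^ab ⊗ F_N(A) → Hom(Hom(H_A^ab, ℤ/N), F_N(A))` is bijective
# for `H_A` finite and `F_N(A) ≅ ℤ/Nℤ`

Mochizuki, *The geometry of Frobenioids II*, Kyushu J. Math. **62** (2008), §2, Def. 2.2 (ii) p. 18
[cite: MochizukiFrdII2008, Def 2.2 p.18]: the duality isomorphism `H¹(H_A, μ_N(A)) ⥲ H_A^ab ⊗ F_N(A)`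
reads the cup product `H¹(H_A, μ_N) → Hom(H¹(H_A, ℤ/N), F_N) = Hom(Hom(H_A^ab, ℤ/N), F_N)` through the
tautological map `θ : a ⊗ φ ↦ (χ ↦ χ(a) · φ)` (`Kummer.thetaHom`, `KummerDualityOfCupProduct.lean`). Cell
abc-iut, cross-layer row **L1-γ₁**, milestone M4 (i) (seat abc-iut-L2-t12): the first of the two
bijectivity inputs of `Kummer.dualityIsoOfCupProduct` is DISCHARGED — pure finite-abelian-group algebra
(Milne, *ADT* I §0 Prop. 0.19 (d): Pontryagin duality of finite groups killed by `N`, with values in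
`ℤ/N`):

* generic (`ZModDuality`): for a finite abelian group `A`, an abelian group `B ≅ ℤ/N` (`N ≠ 0`) and an
  additive `θ : A ⊗ B → Hom(Hom(A, ℤ/N), B)` with `θ(a ⊗ b)(χ) = χ(a) · b`: every tensor is `a ⊗ b₀`
  (`exists_eq_tmul`), `A ⊗ B ≅ A/NA` (`natCard_tensor_eq`), `#Hom(Hom(A, ℤ/N), B) = #(A/NA)`
  (`natCard_dual_eq`, from the tree's `Nat.card_addMonoidHom_zmod`), `θ` injective (points of `A/NA`
  are separated by `Hom(A, ℤ/N)`, tree `exists_addMonoidHom_zmod_apply_ne_zero`) — hence **bijective**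
  (`bijective_of_tmul`);
* **`Kummer.thetaHom_bijective [Finite H_A] [NeZero N] (eFN : F_N(A) ≃+ ZMod N) :
  Function.Bijective (Kummer.thetaHom N O H_A q)`** — the hypothesis `hθ` of
  `dualityIsoOfCupProduct` in the situation of FrdII ("`H_A` finite", "`F_N(A) ≅ ℤ/Nℤ`", p. 18; at the
  local-field binding `Kummer.FNIsCyclic` is abc-iut-L1-t7's `nonempty_fn_equiv_zmod_ofLocalField`).

Classical; nothing here concerns [IUTchIII].
-/

noncomputable section

open scoped TensorProduct

/-! ### Generic: `θ : A ⊗ B → Hom(Hom(A, ℤ/N), B)` is bijective for `A` finite, `B ≅ ℤ/N` -/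

namespace Literature.AlgebraicGeometry.Frobenioids

namespace ZModDuality

open Literature.NumberTheory.GaloisRepresentations

variable {A B : Type} [AddCommGroup A] [AddCommGroup B] {N : ℕ}

/-- `N · A ⊆ A` (multiples of `N`). [cite: MochizukiFrdII2008, Def 2.2 p.18] -/
def nMul (A : Type) [AddCommGroup A] (N : ℕ) : AddSubgroup A := (zsmulAddGroupHom (N : ℤ) : A →+ A).range

/-- `A/NA`. [cite: MochizukiFrdII2008, Def 2.2 p.18] -/
abbrev ModN (A : Type) [AddCommGroup A] (N : ℕ) : Type := A ⧸ nMul A N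

/-- `A/NA` is killed by `N`. [cite: MochizukiFrdII2008, Def 2.2 p.18] -/
theorem ModN.nsmul_eq_zero (x : ModN A N) : N • x = 0 := by
  induction x using QuotientAddGroup.induction_on with
  | H a =>
    rw [← QuotientAddGroup.mk_nsmul, QuotientAddGroup.eq_zero_iff]
    exact ⟨a, by simp [natCast_zsmul]⟩

/-- A homomorphism `A → ℤ/N` kills `N · A`. [cite: MochizukiFrdII2008, Def 2.2 p.18] -/
theorem nMul_le_ker (χ : A →+ ZMod N) : nMul A N ≤ χ.ker := by
  rintro _ ⟨a, rfl⟩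
  rw [AddMonoidHom.mem_ker, zsmulAddGroupHom_apply, map_zsmul, natCast_zsmul, nsmul_eq_mul,
    ZMod.natCast_self, zero_mul]

/-- `Hom(A, ℤ/N) = Hom(A/NA, ℤ/N)`: every `χ` factors through `A/NA`. [cite: MochizukiFrdII2008, Def 2.2 p.18] -/
def liftModN (χ : A →+ ZMod N) : ModN A N →+ ZMod N := QuotientAddGroup.lift _ χ (nMul_le_ker χ)

/-- `liftModN χ [a] = χ a`. [cite: MochizukiFrdII2008, Def 2.2 p.18] -/
@[simp] theorem liftModN_mk (χ : A →+ ZMod N) (a : A) : liftModN χ (a : ModN A N) = χ a := rfl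

/-- `Hom(A/NA, ℤ/N) ≃ Hom(A, ℤ/N)` (precomposition with the quotient map).
[cite: MochizukiFrdII2008, Def 2.2 p.18] -/
def homModNEquiv : (ModN A N →+ ZMod N) ≃ (A →+ ZMod N) where
  toFun ψ := ψ.comp (QuotientAddGroup.mk' _)
  invFun χ := liftModN χ
  left_inv ψ := by
    refine AddMonoidHom.ext fun x => ?_
    induction x using QuotientAddGroup.induction_on with
    | H a => rfl
  right_inv χ := AddMonoidHom.ext fun a => rfl

/-- **Points of `A/NA` are separated by `Hom(A, ℤ/N)`**: if `χ(a) = 0` for every `χ : A → ℤ/N` then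
`a ∈ N · A`. [cite: MochizukiFrdII2008, Def 2.2 p.18] -/
theorem mk_eq_zero_of_forall [Finite A] [NeZero N] (a : A) (h : ∀ χ : A →+ ZMod N, χ a = 0) :
    (a : ModN A N) = 0 := by
  haveI : Finite (ModN A N) := Finite.of_surjective _ (QuotientAddGroup.mk'_surjective (nMul A N))
  by_contra hne
  obtain ⟨ψ, hψ⟩ :=
    exists_addMonoidHom_zmod_apply_ne_zero (n := N) (ModN.nsmul_eq_zero (A := A) (N := N)) hne
  exact hψ (h (homModNEquiv ψ))

/-- The generator `b₀ := eB⁻¹(1)` of `B ≅ ℤ/N`: `b = (eB b).val · b₀`. [cite: MochizukiFrdII2008, Def 2.2 p.18] -/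
theorem eq_zsmul_gen [NeZero N] (eB : B ≃+ ZMod N) (b : B) : b = ((eB b).val : ℤ) • eB.symm 1 := by
  apply eB.injective
  rw [map_zsmul, AddEquiv.apply_symm_apply, zsmul_eq_mul, mul_one, Int.cast_natCast,
    ZMod.natCast_zmod_val]

/-- **Every element of `A ⊗ B` is an elementary tensor `a ⊗ b₀`** (`B` cyclic).
[cite: MochizukiFrdII2008, Def 2.2 p.18] -/
theorem exists_eq_tmul [NeZero N] (eB : B ≃+ ZMod N) (t : A ⊗[ℤ] B) : ∃ a : A, t = a ⊗ₜ eB.symm 1 := by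
  induction t using TensorProduct.induction_on with
  | zero => exact ⟨0, (TensorProduct.zero_tmul _ _).symm⟩
  | tmul a b =>
    refine ⟨((eB b).val : ℤ) • a, ?_⟩
    rw [TensorProduct.smul_tmul, ← eq_zsmul_gen eB b]
  | add t t' ht ht' =>
    obtain ⟨a, rfl⟩ := ht
    obtain ⟨a', rfl⟩ := ht'
    exact ⟨a + a', (TensorProduct.add_tmul _ _ _).symm⟩

/-- `c · b₀ = 0` in `B ≅ ℤ/N` forces `c = 0`. [cite: MochizukiFrdII2008, Def 2.2 p.18] -/
theorem eq_zero_of_smul_gen_eq_zero (hB : ∀ b : B, N • b = 0) (eB : B ≃+ ZMod N) (c : ZMod N)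
    (h : (letI := AddCommGroup.zmodModule hB; c • eB.symm 1) = 0) : c = 0 := by
  letI := AddCommGroup.zmodModule hB
  have h1 := congrArg eB h
  rw [ZMod.map_smul eB c, AddEquiv.apply_symm_apply, smul_eq_mul, mul_one, map_zero] at h1
  exact h1

/-- `a ⊗ b = 0` when `a ∈ N · A` (as `N · b = 0`). [cite: MochizukiFrdII2008, Def 2.2 p.18] -/
theorem tmul_eq_zero_of_mem (hB : ∀ b : B, N • b = 0) {a : A} (ha : a ∈ nMul A N) (b : B) :
    a ⊗ₜ[ℤ] b = 0 := by
  obtain ⟨a', rfl⟩ := ha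
  rw [zsmulAddGroupHom_apply, TensorProduct.smul_tmul, natCast_zsmul, hB, TensorProduct.tmul_zero]

/-- **`θ` is injective** (`A` finite, `B ≅ ℤ/N`): if `χ(a) · b₀ = 0` for all `χ` then all `χ(a) = 0`, so
`a ∈ N · A` and `a ⊗ b₀ = 0`. [cite: MochizukiFrdII2008, Def 2.2 p.18] -/
theorem injective_of_tmul [Finite A] [NeZero N] (hB : ∀ b : B, N • b = 0) (eB : B ≃+ ZMod N)
    (θ : A ⊗[ℤ] B →+ ((A →+ ZMod N) →+ B))
    (hθ : ∀ (a : A) (b : B) (χ : A →+ ZMod N),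
      θ (a ⊗ₜ b) χ = (letI := AddCommGroup.zmodModule hB; χ a • b)) :
    Function.Injective θ := by
  refine (injective_iff_map_eq_zero θ).2 fun t ht => ?_
  obtain ⟨a, rfl⟩ := exists_eq_tmul eB t
  have hχ : ∀ χ : A →+ ZMod N, χ a = 0 := fun χ =>
    eq_zero_of_smul_gen_eq_zero hB eB (χ a) (by rw [← hθ, ht, AddMonoidHom.zero_apply])
  exact tmul_eq_zero_of_mem hB ((QuotientAddGroup.eq_zero_iff a).1 (mk_eq_zero_of_forall a hχ)) _

/-- `A/NA → A ⊗ B`, `[a] ↦ a ⊗ b₀` (well defined: `N a' ⊗ b₀ = a' ⊗ N b₀ = 0`).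
[cite: MochizukiFrdII2008, Def 2.2 p.18] -/
def modNToTensor (hB : ∀ b : B, N • b = 0) (eB : B ≃+ ZMod N) : ModN A N →+ A ⊗[ℤ] B :=
  QuotientAddGroup.lift _ ((TensorProduct.mk ℤ A B).flip (eB.symm 1)).toAddMonoidHom (by
    intro a ha
    rw [AddMonoidHom.mem_ker]
    exact tmul_eq_zero_of_mem hB ha _)

/-- `modNToTensor [a] = a ⊗ b₀`. [cite: MochizukiFrdII2008, Def 2.2 p.18] -/
@[simp] theorem modNToTensor_mk (hB : ∀ b : B, N • b = 0) (eB : B ≃+ ZMod N) (a : A) :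
    modNToTensor hB eB (a : ModN A N) = a ⊗ₜ eB.symm 1 := rfl

/-- `modNToTensor` is surjective (every tensor is `a ⊗ b₀`). [cite: MochizukiFrdII2008, Def 2.2 p.18] -/
theorem modNToTensor_surjective [NeZero N] (hB : ∀ b : B, N • b = 0) (eB : B ≃+ ZMod N) :
    Function.Surjective (modNToTensor (A := A) hB eB) := by
  intro t
  obtain ⟨a, rfl⟩ := exists_eq_tmul eB t
  exact ⟨a, rfl⟩

/-- The bilinear map `(a, b) ↦ eB(b) · [a] : A × B → A/NA`. [cite: MochizukiFrdII2008, Def 2.2 p.18] -/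
def tensorToModNBilin (eB : B ≃+ ZMod N) : A →ₗ[ℤ] B →ₗ[ℤ] ModN A N :=
  letI := AddCommGroup.zmodModule (ModN.nsmul_eq_zero (A := A) (N := N))
  LinearMap.mk₂ ℤ (fun (a : A) (b : B) => (eB b • (a : ModN A N) : ModN A N))
    (fun a a' b => by rw [QuotientAddGroup.mk_add, smul_add])
    (fun c a b => by
      rw [QuotientAddGroup.mk_zsmul]
      exact (ZMod.map_smul (zsmulAddGroupHom c : ModN A N →+ ModN A N) (eB b) (a : ModN A N)).symm)
    (fun a b b' => by rw [map_add, add_smul])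
    (fun c a b => by rw [map_zsmul, zsmul_eq_mul, mul_smul, Int.cast_smul_eq_zsmul])

/-- `tensorToModNBilin a b = eB(b) · [a]`. [cite: MochizukiFrdII2008, Def 2.2 p.18] -/
theorem tensorToModNBilin_apply (eB : B ≃+ ZMod N) (a : A) (b : B) :
    tensorToModNBilin eB a b =
      (letI := AddCommGroup.zmodModule (ModN.nsmul_eq_zero (A := A) (N := N)); eB b • (a : ModN A N)) :=
  rfl

/-- `A ⊗ B → A/NA`, `a ⊗ b ↦ eB(b) · [a]` — a retraction of `modNToTensor`.
[cite: MochizukiFrdII2008, Def 2.2 p.18] -/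
def tensorToModN (eB : B ≃+ ZMod N) : A ⊗[ℤ] B →+ ModN A N :=
  (TensorProduct.lift (tensorToModNBilin eB)).toAddMonoidHom

/-- `tensorToModN (a ⊗ b) = eB(b) · [a]`. [cite: MochizukiFrdII2008, Def 2.2 p.18] -/
theorem tensorToModN_tmul (eB : B ≃+ ZMod N) (a : A) (b : B) :
    tensorToModN eB (a ⊗ₜ b) =
      (letI := AddCommGroup.zmodModule (ModN.nsmul_eq_zero (A := A) (N := N)); eB b • (a : ModN A N)) := by
  rw [← tensorToModNBilin_apply]
  exact TensorProduct.lift.tmul (f' := tensorToModNBilin eB) a b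

/-- `tensorToModN ∘ modNToTensor = id`. [cite: MochizukiFrdII2008, Def 2.2 p.18] -/
theorem tensorToModN_modNToTensor (hB : ∀ b : B, N • b = 0) (eB : B ≃+ ZMod N) (x : ModN A N) :
    tensorToModN eB (modNToTensor hB eB x) = x := by
  induction x using QuotientAddGroup.induction_on with
  | H a =>
    rw [modNToTensor_mk, tensorToModN_tmul, AddEquiv.apply_symm_apply]
    letI := AddCommGroup.zmodModule (ModN.nsmul_eq_zero (A := A) (N := N))
    exact one_smul (ZMod N) _

/-- **`#(A ⊗ B) = #(A/NA)`** (`B ≅ ℤ/N`). [cite: MochizukiFrdII2008, Def 2.2 p.18] -/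
theorem natCard_tensor_eq [NeZero N] (hB : ∀ b : B, N • b = 0) (eB : B ≃+ ZMod N) :
    Nat.card (A ⊗[ℤ] B) = Nat.card (ModN A N) :=
  (Nat.card_congr (Equiv.ofBijective (modNToTensor hB eB)
    ⟨fun x y h => by
      rw [← tensorToModN_modNToTensor hB eB x, ← tensorToModN_modNToTensor hB eB y, h],
      modNToTensor_surjective hB eB⟩)).symm

/-- `Hom(A, ℤ/N)` is killed by `N`. [cite: MochizukiFrdII2008, Def 2.2 p.18] -/
theorem hom_nsmul_eq_zero (χ : A →+ ZMod N) : N • χ = 0 := by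
  ext a
  change N • χ a = 0
  rw [nsmul_eq_mul, ZMod.natCast_self, zero_mul]

/-- `Hom(C, B) ≃ Hom(C, ℤ/N)` along `eB`. [cite: MochizukiFrdII2008, Def 2.2 p.18] -/
def homCongr (eB : B ≃+ ZMod N) (C : Type) [AddCommGroup C] : (C →+ B) ≃ (C →+ ZMod N) where
  toFun ψ := eB.toAddMonoidHom.comp ψ
  invFun ψ := eB.symm.toAddMonoidHom.comp ψ
  left_inv ψ := AddMonoidHom.ext fun c => eB.symm_apply_apply (ψ c)
  right_inv ψ := AddMonoidHom.ext fun c => eB.apply_symm_apply (ψ c)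

/-- **`#Hom(Hom(A, ℤ/N), B) = #(A/NA)`** (`A` finite, `B ≅ ℤ/N`; the tree's
`Nat.card_addMonoidHom_zmod` twice). [cite: MochizukiFrdII2008, Def 2.2 p.18] -/
theorem natCard_dual_eq [Finite A] [NeZero N] (eB : B ≃+ ZMod N) :
    Nat.card ((A →+ ZMod N) →+ B) = Nat.card (ModN A N) := by
  haveI : Finite (A →+ ZMod N) := finite_addMonoidHom_zmod A N
  haveI : Finite (ModN A N) := Finite.of_surjective _ (QuotientAddGroup.mk'_surjective (nMul A N))
  rw [Nat.card_congr (homCongr eB (A →+ ZMod N)),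
    Nat.card_addMonoidHom_zmod (hom_nsmul_eq_zero (A := A) (N := N)),
    ← Nat.card_congr (homModNEquiv (A := A) (N := N)),
    Nat.card_addMonoidHom_zmod (ModN.nsmul_eq_zero (A := A) (N := N))]

/-- `Hom(Hom(A, ℤ/N), B)` is finite. [cite: MochizukiFrdII2008, Def 2.2 p.18] -/
theorem finite_dual [Finite A] [NeZero N] (eB : B ≃+ ZMod N) : Finite ((A →+ ZMod N) →+ B) := by
  haveI : Finite (A →+ ZMod N) := finite_addMonoidHom_zmod A N
  haveI : Finite ((A →+ ZMod N) →+ ZMod N) := finite_addMonoidHom_zmod _ N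
  exact Finite.of_equiv _ (homCongr eB (A →+ ZMod N)).symm

/-- **`θ` is bijective** for `A` finite and `B ≅ ℤ/N`: injective, and source and target both have
`#(A/NA)` elements. [cite: MochizukiFrdII2008, Def 2.2 p.18] -/
theorem bijective_of_tmul [Finite A] [NeZero N] (hB : ∀ b : B, N • b = 0) (eB : B ≃+ ZMod N)
    (θ : A ⊗[ℤ] B →+ ((A →+ ZMod N) →+ B))
    (hθ : ∀ (a : A) (b : B) (χ : A →+ ZMod N),
      θ (a ⊗ₜ b) χ = (letI := AddCommGroup.zmodModule hB; χ a • b)) :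
    Function.Bijective θ := by
  haveI := finite_dual (A := A) eB
  refine (injective_of_tmul hB eB θ hθ).bijective_of_nat_card_le (le_of_eq ?_)
  rw [natCard_dual_eq eB, natCard_tensor_eq hB eB]

end ZModDuality

/-! ### `Kummer.thetaHom` is bijective for `H_A` finite and `F_N(A) ≅ ℤ/Nℤ` -/

namespace Kummer

variable {Γ : Type} [Group Γ] [TopologicalSpace Γ] [DiscreteTopology Γ]
  (N : ℕ) (O : Type) [CommMonoid O] [MulDistribMulAction Γ O] (HA : Subgroup Γ)
  {H : Type} [Group H] [TopologicalSpace H] [IsTopologicalGroup H] (q : H →ₜ* HA)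

/-- **`θ : H_A^ab ⊗ F_N(A) → Hom(Hom(H_A^ab, ℤ/N), F_N(A))` is bijective** when `H_A` is finite and
`F_N(A) ≅ ℤ/Nℤ` (FrdII p. 18: "`F_N(A) ≅ H²(H, μ_N(A)) ≅ ℤ/Nℤ`") — the input `hθ` of
`Kummer.dualityIsoOfCupProduct`, DISCHARGED. [cite: MochizukiFrdII2008, Def 2.2 p.18] -/
theorem thetaHom_bijective [Finite HA] [NeZero N] (eFN : FN N O HA q ≃+ ZMod N) :
    Function.Bijective (thetaHom N O HA q) := by
  haveI : Finite (Abelianization HA) := Finite.of_surjective _ (QuotientGroup.mk_surjective)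
  haveI : Finite (Additive (Abelianization HA)) := Finite.of_equiv _ Additive.ofMul
  exact ZModDuality.bijective_of_tmul (FN.nsmul_eq_zero N O HA q) eFN (thetaHom N O HA q)
    (thetaHom_tmul N O HA q)

end Kummer

end Literature.AlgebraicGeometry.Frobenioids
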